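/-
M16c (decomp-mm-lens-5 g29) — the hand-1 residual RE-TYPED WITH CORRECTIONS: cheap tangent-deflating
PAIRS `(μ, ρ)` on the hidden ∧ twisted ∧ ¬row-split class; the circuit-plumbing statement
`CorrectedForwardModeAD`; the assembly of `BoundedOrderPurification (K = 2)` from them.  No sorry.
-/
import Mathlib
import Summits.MatrixMultiplication.Statement
import Summits.MatrixMultiplication.MatrixMultiplication.Theorems.GraphEquationsCorrectedDeflation

/-!
# Graph equations — the corrected residual of `BoundedOrderPurification (K = 2)`

Supporting kernels for the crux `MultiplicityReduction` of route `GraphEquations`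
(line `purisplit`, stub `BoundedOrderPurification`, rung `K = 2`).

`GraphEquationsFlatDeflation` split rung `2` of BOP′ into structural rungs and the residual
`HiddenTwistedDeflation K₀` (cheap tangent KERNEL fields on the hidden ∧ twisted class).
`GraphEquationsCorrectedDeflation` showed that a kernel field is more than is needed: a field `μ`
tangent over `y'` together with the graph restrictions `ρ_j ∈ ℂ[A,B]` of the `D_μ t_j`
(`D_μ t_j − ι ρ_j ∈ I`) deflates to order `1`, and on the ROW-SPLIT class this costs nothing beyond
forward-mode AD.  This file records the node that results.

* `CorrectedForwardModeAD` — **named plumbing statement** (circuit surgery, routine; the analogue of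
  the theorem `forwardModeAD`): from fan-in-two programs `E` and `E_{μρ}` (the latter computing the
  `ι μ_q` and the nonzero `ι ρ_j`) build a fan-in-two system containing the tests of `E` and the
  corrected derivatives `D_μ t_j − ι ρ_j`, with no other tests, of cost `≤ 5·cost E + cost E_{μρ}`
  (forward-mode AD, `4·cost E + cost E_{μρ}`, plus one subtraction gate per test gate).  A SUPPORT
  item for a prover hand, not a crux.
* `HiddenTwistedCorrDeflation K₀ β β'` — **the residual, corrected form**: for correct `E` of cost
  `≤ c·n^β` whose test ideal is initially isolated to order `2` over `y`, NOT test-isolated to order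
  `K₀` there, NOT const-deflatable there, and NOT row-split, there are `y'`, a field `μ`, corrections
  `ρ` and a fan-in-two program of cost `≤ c'·n^{β'}` computing the `ι μ_q` and the nonzero `ι ρ_j`,
  with `D_μ t_j − ι ρ_j ∈ I` and every system containing the `ρ`-corrected `μ`-deflation of `E`
  initially isolated to order `1` over `y'`.
  WEAKER than `HiddenTwistedDeflation K₀` (`HiddenTwistedDeflation.corr`: take `ρ = 0`; the only
  subtlety is that a vanishing `D_μ t_j` may be omitted — `EqSystem.padZero`), hence than
  `UniformKernelFieldDeflation` (`hiddenTwistedCorrDeflation_of_uniform`); monotone in `K₀`; FREE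
  under `S` in the window `β' ≤ ω` (`nec_hiddenTwistedCorrDeflation_window`).
* `boundedOrderPurification_two_of_corrected` — **ASSEMBLY**:
  `CorrectedForwardModeAD ∧ (∀ 2 ≤ β < β' ≤ ω, HiddenTwistedCorrDeflation K₀ β β') ⟹ BOP′(2)`,
  by cases per `n`: `ω < β'` (tree rung) ∣ test-isolated (pure of order `2K₀`) ∣ const-deflatable
  (`exists_reduced_deflation_of_constDeflatable`) ∣ row-split
  (`exists_reduced_corrDeflation_of_rowSplit`) ∣ residual + plumbing; uniform order `2·max K₀ 1`,
  constant `5·max c 0 + max c' 0 + 1`.  `nec_boundedOrderPurification_two'`: under `S` (and the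
  plumbing) rung `2` of BOP′ holds.

NODE (hand 1, rung `K = 2`):  BOP′(2) ⟸ [`ω < β'`: TREE] ∧ [test-isolated: TREE] ∧
[const-deflatable: PROVED, M16a] ∧ [row-split: PROVED, M16b] ∧ [`CorrectedForwardModeAD`: SUPPORT,
routine] ∧ [`HiddenTwistedCorrDeflation K₀` for `β' ≤ ω`: RESIDUAL — UNDECIDED · NEC (free under
`S`) · SUFF · WEAKER than every earlier typing].  What a refuter of the residual must now exhibit: a
correct family, `cost = O(n^β)` with `β < ω`, hidden-isolated to order `2`, twisted, with a test that
is neither zero-row nor `c`-affine, and admitting NO cheap tangent-deflating pair `(μ, ρ)` over ANY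
point `y'` — in particular not const-deflatable over any `y'` (the example of
`GraphEquationsFlatDeflation` is const-deflatable over generic `y'`, so it is not a candidate).
-/

-- dupNamespace: forced by the nested Summit.MatrixMultiplication.MatrixMultiplication layout (D-0017)
set_option linter.dupNamespace false

noncomputable section

open scoped BigOperators

namespace Summit.MatrixMultiplication.MatrixMultiplication.Theorems.GraphEquations

open MvPolynomial Literature.Computability.AlgebraicComplexity
open Literature.Computability.AlgebraicComplexity.ArithCircuit

variable {n : ℕ}

namespace EqSystem

/-! ## Zero padding (a vanishing deflated test may be omitted) -/

/-- `E` with one more test index, out of range, whose test polynomial is `0` (same circuit). -/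
def padZero (E : EqSystem n) : EqSystem n where
  circuit := E.circuit
  tests := E.tests ++ [E.circuit.gates.length]

/-- Same test polynomials. -/
theorem padZero_testPoly (E : EqSystem n) (j : ℕ) : E.padZero.testPoly j = E.testPoly j := rfl

/-- Same cost. -/
theorem padZero_cost (E : EqSystem n) : E.padZero.cost = E.cost := rfl

/-- The out-of-range test index has test polynomial `0`. -/
theorem testPoly_gates_length (E : EqSystem n) : E.testPoly E.circuit.gates.length = 0 := by
  unfold testPoly
  refine List.getD_eq_default _ _ ?_
  rw [gateValues_length]

/-- The tests of the padding. -/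
theorem mem_padZero_tests {E : EqSystem n} {j : ℕ} :
    j ∈ E.padZero.tests ↔ j ∈ E.tests ∨ j = E.circuit.gates.length := by
  simp [padZero]

/-- Padding with the zero test does not change isolation of the test ideal. -/
theorem IdealInitIsolatedAt.of_padZero {E : EqSystem n} {K : ℕ} {y : MatMulVars n → ℂ}
    (h : E.padZero.IdealInitIsolatedAt K y) : E.IdealInitIsolatedAt K y := by
  refine (E.idealInitIsolatedAt_iff K y).mpr
    (((E.padZero.idealInitIsolatedAt_iff K y).mp h).mono (Ideal.span_le.mpr ?_))
  intro t ht
  obtain ⟨j, hj, rfl⟩ := (E.padZero.mem_testSet_iff t).mp ht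
  rcases mem_padZero_tests.mp hj with hj | rfl
  · exact Ideal.subset_span ((E.mem_testSet_iff _).mpr ⟨j, hj, rfl⟩)
  · rw [padZero_testPoly, testPoly_gates_length]
    exact Ideal.zero_mem _

/-- A system containing the UNcorrected (`ρ = 0`) `μ`-deflation in the sense of `CorrDeflatesTo`
contains the `μ`-deflation after zero padding. -/
theorem CorrDeflatesTo.deflatesTo_padZero {E E' : EqSystem n}
    {μ : Fin n × Fin n → MvPolynomial (MatMulVars n) ℂ} (h : E.CorrDeflatesTo μ (fun _ => 0) E') :
    E.DeflatesTo μ E'.padZero := by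
  refine ⟨fun j hj => ?_, fun j hj => ?_⟩
  · obtain ⟨j', hj', he⟩ := h.1 j hj
    exact ⟨j', mem_padZero_tests.mpr (Or.inl hj'), he⟩
  · rcases h.2 j hj with h0 | ⟨j', hj', he⟩
    · refine ⟨E'.circuit.gates.length, mem_padZero_tests.mpr (Or.inr rfl), ?_⟩
      rw [map_zero, sub_zero] at h0
      rw [padZero_testPoly, testPoly_gates_length, h0]
    · exact ⟨j', mem_padZero_tests.mpr (Or.inl hj'), by rw [padZero_testPoly, he, map_zero, sub_zero]⟩

end EqSystem

/-! ## The plumbing statement -/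

/-- **`CorrectedForwardModeAD`** (named statement; circuit plumbing, routine — the analogue of the
theorem `forwardModeAD`).  From fan-in-two programs `E` and `E_{μρ}` over the graph variables, the
latter computing the field values `ι μ_q` and, for every test `t_j` of `E` with `ρ_j ≠ 0`, the
correction `ι ρ_j` (no correction on null tests), there is a fan-in-two system containing the tests of
`E` and the corrected derivatives `D_μ t_j − ι ρ_j` (those that are not `0`), with no other tests, of
cost `≤ 5·cost E + cost E_{μρ}` (forward-mode AD plus one subtraction gate per test gate). -/
def CorrectedForwardModeAD : Prop :=
  ∀ (n : ℕ) (E Eμ : EqSystem n) (μ : Fin n × Fin n → MvPolynomial (MatMulVars n) ℂ)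
    (ρ : ℕ → MvPolynomial (MatMulVars n) ℂ),
    E.circuit.IsFanInTwo → Eμ.circuit.IsFanInTwo →
    (∀ q, ∃ i ∈ Eμ.tests, Eμ.testPoly i = liftAB n (μ q)) →
    (∀ j ∈ E.tests, ρ j = 0 ∨ ∃ i ∈ Eμ.tests, Eμ.testPoly i = liftAB n (ρ j)) →
    (∀ j ∈ E.tests, E.testPoly j = 0 → ρ j = 0) →
    ∃ E' : EqSystem n, E'.circuit.IsFanInTwo ∧ E.CorrDeflatesTo μ ρ E' ∧
      (∀ j' ∈ E'.tests, (∃ j ∈ E.tests, E'.testPoly j' = E.testPoly j) ∨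
        (∃ j ∈ E.tests, E'.testPoly j' = derivC μ (E.testPoly j) - liftAB n (ρ j))) ∧
      E'.cost ≤ 5 * E.cost + Eμ.cost

/-! ## The residual, corrected form -/

/-- **`HiddenTwistedCorrDeflation K₀ β β'`** — cheap tangent-deflating PAIRS `(μ, ρ)` on the
hidden ∧ twisted ∧ ¬row-split class: for correct `E` of cost `≤ c·n^β` whose test ideal is initially
isolated to order `2` over `y`, not test-isolated to order `K₀` over `y`, not const-deflatable over
`y` and not row-split, there are `y'`, a field `μ`, corrections `ρ_j ∈ ℂ[A,B]` and a fan-in-two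
program of cost `≤ c'·n^{β'}` computing the `ι μ_q` and the nonzero `ι ρ_j`, with
`D_μ t_j − ι ρ_j ∈ I` for every test and every system containing the `ρ`-corrected `μ`-deflation
of `E` initially isolated to order `1` over `y'`. -/
def HiddenTwistedCorrDeflation (K₀ : ℕ) (β β' : ℝ) : Prop :=
  ∀ c : ℝ, ∃ c' : ℝ, ∀ n : ℕ, 1 ≤ n → ∀ (E : EqSystem n) (y : MatMulVars n → ℂ),
    E.Correct → E.IdealInitIsolatedAt 2 y → ¬ E.InitIsolatedAt K₀ y → ¬ E.ConstDeflatable y →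
    ¬ E.RowSplit → (E.cost : ℝ) ≤ c * (n : ℝ) ^ β →
    ∃ (y' : MatMulVars n → ℂ) (μ : Fin n × Fin n → MvPolynomial (MatMulVars n) ℂ)
      (ρ : ℕ → MvPolynomial (MatMulVars n) ℂ) (Eμ : EqSystem n),
      Eμ.circuit.IsFanInTwo ∧
      (∀ q, ∃ i ∈ Eμ.tests, Eμ.testPoly i = liftAB n (μ q)) ∧
      (∀ j ∈ E.tests, ρ j = 0 ∨ ∃ i ∈ Eμ.tests, Eμ.testPoly i = liftAB n (ρ j)) ∧
      (Eμ.cost : ℝ) ≤ c' * (n : ℝ) ^ β' ∧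
      (∀ j ∈ E.tests, derivC μ (E.testPoly j) - liftAB n (ρ j) ∈ graphIdeal n) ∧
      (∀ E'' : EqSystem n, E.CorrDeflatesTo μ ρ E'' → E''.IdealInitIsolatedAt 1 y')

/-- **The corrected residual is WEAKER than the kernel-field residual** (`ρ = 0`). -/
theorem HiddenTwistedDeflation.corr {K₀ : ℕ} {β β' : ℝ} (h : HiddenTwistedDeflation K₀ β β') :
    HiddenTwistedCorrDeflation K₀ β β' := by
  intro c
  obtain ⟨c', hc'⟩ := h c
  refine ⟨c', fun n hn E y hE hiso hK hC _ hcost => ?_⟩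
  obtain ⟨y', μ, Eμ, hfan, hμ, hcμ, hI, hdefl⟩ := hc' n hn E y hE hiso hK hC hcost
  refine ⟨y', μ, fun _ => 0, Eμ, hfan, hμ, fun j _ => Or.inl rfl, hcμ,
    fun j hj => by simpa only [map_zero, sub_zero] using hI j hj, fun E'' hD => ?_⟩
  exact EqSystem.IdealInitIsolatedAt.of_padZero (hdefl _ hD.deflatesTo_padZero)

/-- Hence weaker than `UniformKernelFieldDeflation`. -/
theorem hiddenTwistedCorrDeflation_of_uniform {K₀ : ℕ} {β β' : ℝ} (h : UniformKernelFieldDeflation β β') :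
    HiddenTwistedCorrDeflation K₀ β β' :=
  (hiddenTwistedDeflation_of_uniform h).corr

/-- Monotone in the test-isolation order excluded. -/
theorem HiddenTwistedCorrDeflation.mono_order {K₀ K₁ : ℕ} {β β' : ℝ}
    (h : HiddenTwistedCorrDeflation K₀ β β') (hK : K₀ ≤ K₁) : HiddenTwistedCorrDeflation K₁ β β' := by
  intro c
  obtain ⟨c', hc'⟩ := h c
  exact ⟨c', fun n hn E y hE hiso hK₁ hC hR hcost =>
    hc' n hn E y hE hiso (fun hK₀ => hK₁ (hK₀.mono hK)) hC hR hcost⟩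

/-- **Under `S` the corrected residual is free in the window `β' ≤ ω`.** -/
theorem nec_hiddenTwistedCorrDeflation_window (hS : _root_.MatrixMultiplication) (K₀ : ℕ) :
    ∀ β β' : ℝ, 2 ≤ β → β < β' → β' ≤ omega ℂ → HiddenTwistedCorrDeflation K₀ β β' :=
  fun β β' hβ hββ' hω => (nec_hiddenTwistedDeflation_window hS K₀ β β' hβ hββ' hω).corr

/-! ## Assembly of `BoundedOrderPurification (K = 2)` -/

/-- **ASSEMBLY.**  Plumbing and the windowed corrected residual give rung `2` of BOP′:
`2 ≤ β`, `EqAdmissibleIdealIso β 2`, `β < β'` ⇒ `EqAdmissiblePure β'`. -/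
theorem boundedOrderPurification_two_of_corrected (K₀ : ℕ) (hAD : CorrectedForwardModeAD)
    (hR : ∀ β β' : ℝ, 2 ≤ β → β < β' → β' ≤ omega ℂ → HiddenTwistedCorrDeflation K₀ β β')
    (β : ℝ) (hβ : 2 ≤ β) (hiso : EqAdmissibleIdealIso β 2) (β' : ℝ) (hββ' : β < β') :
    EqAdmissiblePure β' := by
  by_cases hω : omega ℂ < β'
  · exact eqAdmissiblePure_of_idealIso_one (eqAdmissibleIdealIso_one_of_omega_lt hω)
  obtain ⟨c, hc⟩ := hiso
  obtain ⟨c', hc'⟩ := hR β β' hβ hββ' (not_lt.mp hω) c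
  refine ⟨2 * max K₀ 1, 5 * max c 0 + max c' 0 + 1, fun n hn => ?_⟩
  obtain ⟨E, hE, ⟨y, hy⟩, hcost⟩ := hc n hn
  have hK2 : 2 ≤ 2 * max K₀ 1 := by omega
  have hn1 : (1 : ℝ) ≤ n := by exact_mod_cast hn
  have hpow : (n : ℝ) ^ β ≤ (n : ℝ) ^ β' := Real.rpow_le_rpow_of_exponent_le hn1 hββ'.le
  have hpos : 0 ≤ (n : ℝ) ^ β := Real.rpow_nonneg (Nat.cast_nonneg n) β
  have hpos' : 0 ≤ (n : ℝ) ^ β' := Real.rpow_nonneg (Nat.cast_nonneg n) β'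
  have hsq : ((n * n : ℕ) : ℝ) ≤ (n : ℝ) ^ β' := by
    rw [Nat.cast_mul, ← sq, ← Real.rpow_two]
    exact Real.rpow_le_rpow_of_exponent_le hn1 (hβ.trans hββ'.le)
  have h1 : (E.cost : ℝ) ≤ max c 0 * (n : ℝ) ^ β' :=
    hcost.trans ((mul_le_mul_of_nonneg_right (le_max_left c 0) hpos).trans
      (mul_le_mul_of_nonneg_left hpow (le_max_right c 0)))
  have hc'0 : 0 ≤ max c' 0 * (n : ℝ) ^ β' := mul_nonneg (le_max_right c' 0) hpos'
  by_cases htest : E.InitIsolatedAt K₀ y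
  · refine ⟨E, hE, htest.pureIsolated.mono (by omega), ?_⟩
    nlinarith [h1, hc'0, hpos']
  by_cases hcd : E.ConstDeflatable y
  · obtain ⟨E', hE', hred, hcostE'⟩ := EqSystem.exists_reduced_deflation_of_constDeflatable hE hcd
    refine ⟨E', hE', EqSystem.pureIsolated_of_reducedAt_graphPoint hE' hred hK2, ?_⟩
    have h3 : (E'.cost : ℝ) ≤ 4 * E.cost + (n * n : ℕ) := by exact_mod_cast hcostE'
    nlinarith [h1, h3, hsq, hc'0]
  by_cases hrs : E.RowSplit
  · obtain ⟨E', hE', hred, hcostE'⟩ := EqSystem.exists_reduced_corrDeflation_of_rowSplit hE hy hrs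
    refine ⟨E', hE', EqSystem.pureIsolated_of_reducedAt_graphPoint hE' hred hK2, ?_⟩
    have h3 : (E'.cost : ℝ) ≤ 4 * E.cost + (n * n : ℕ) := by exact_mod_cast hcostE'
    nlinarith [h1, h3, hsq, hc'0]
  · obtain ⟨y', μ, ρ, Eμ, hfanμ, hμ, hρ, hμcost, hI, hgood⟩ := hc' n hn E y hE hy htest hcd hrs hcost
    have hρ0 : ∀ j ∈ E.tests, E.testPoly j = 0 → ρ j = 0 := fun j hj h0 => by
      have h := hI j hj
      rw [h0, derivC_zero, zero_sub, neg_mem_iff] at h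
      exact MvPolynomial.funext fun x => by
        simpa only [eval_graphPoint_liftAB, map_zero] using
          eval_eq_zero_of_mem_graphIdeal h (graphPoint_mem_mmGraph x)
    obtain ⟨E', hfan', hD, htests, hcost'⟩ := hAD n E Eμ μ ρ hE.1 hfanμ hμ hρ hρ0
    have hE' : E'.Correct := hE.of_contains hfan' hD.1 fun j' hj' => by
      rcases htests j' hj' with ⟨j, hj, he⟩ | ⟨j, hj, he⟩
      · rw [he]; exact mem_graphIdeal_of_vanishing fun x hx => hE.eval_testPoly_eq_zero hx hj
      · rw [he]; exact hI j hj
    refine ⟨E', hE', EqSystem.pureIsolated_of_reducedAt_graphPoint hE'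
      (EqSystem.reducedAt_of_idealInitIsolatedAt_one hE' (hgood E' hD)) hK2, ?_⟩
    have h2 : (Eμ.cost : ℝ) ≤ max c' 0 * (n : ℝ) ^ β' :=
      hμcost.trans (mul_le_mul_of_nonneg_right (le_max_left c' 0) hpos')
    have h3 : (E'.cost : ℝ) ≤ 5 * E.cost + Eμ.cost := by exact_mod_cast hcost'
    nlinarith [h1, h2, h3, hpos']

/-- The same assembly from the UNWINDOWED corrected residual. -/
theorem boundedOrderPurification_two_of_corrected' (K₀ : ℕ) (hAD : CorrectedForwardModeAD)
    (hR : ∀ β β' : ℝ, 2 ≤ β → β < β' → HiddenTwistedCorrDeflation K₀ β β')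
    (β : ℝ) (hβ : 2 ≤ β) (hiso : EqAdmissibleIdealIso β 2) (β' : ℝ) (hββ' : β < β') :
    EqAdmissiblePure β' :=
  boundedOrderPurification_two_of_corrected K₀ hAD (fun β β' hβ hββ' _ => hR β β' hβ hββ') β hβ hiso β' hββ'

/-- **Under `S` (and the plumbing) rung `2` of BOP′ holds** — NEC check of the corrected split. -/
theorem nec_boundedOrderPurification_two' (hS : _root_.MatrixMultiplication) (hAD : CorrectedForwardModeAD)
    (β : ℝ) (hβ : 2 ≤ β) (hiso : EqAdmissibleIdealIso β 2) (β' : ℝ) (hββ' : β < β') :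
    EqAdmissiblePure β' :=
  boundedOrderPurification_two_of_corrected 0 hAD (nec_hiddenTwistedCorrDeflation_window hS 0) β hβ hiso β' hββ'

end Summit.MatrixMultiplication.MatrixMultiplication.Theorems.GraphEquations

end
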